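import Summits.BirchSwinnertonDyer.BirchSwinnertonDyer.Theorems.ResidualThetaTransportAtTwoSignedMuSeedAtTwoPlusEvenSymplecticFreeParity
import HarnessLib

/-!
# Seed crux `SignedMuSeedAtTwoPlus` (stmt-BirchSwinnertonDyer-21438), line `ct-involution-parity`:
# the QF-splitting input of stub S3 — a free `(ℤ/N)[g]`-orbit of length `m` in a module of exponent `N`
# with `g^m = 1` is a `g`-stable DIRECT SUMMAND (self-injectivity of `(ℤ/N)[C_m]`, via `ℚ/ℤ`-characters)

Cell `bsd-wall`, width seat `bsd-wall-rtt-p4-w2` g9 (seventh file on the line's pure algebra).  HONEST FRAMING: THEOREMS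
ONLY — no definition, no named fact, no instance, no `sorry`; pure algebra; closes no item; BSD is NOT proved by this.

## Why

Stub S3 `OddFreeGradeFromFineMuAtTwo` (line card): «`(Λ/2^k)/ω_n = (ℤ/2^k)[G_n]` is projective AND injective over the
Frobenius ring `(ℤ/2^k)[G_n]`, so it splits off any `(ℤ/2^k)[G_n]`-module containing it».  This file proves exactly that
splitting, for any exponent `N` and any cyclic action, WITHOUT quasi-Frobenius theory: the coordinate functional of the
free orbit is extended to the whole module through `ℚ/ℤ` (Mathlib's `CharacterModule.dual_surjective_of_injective`: `ℚ/ℤ`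
is divisible), pulled back to `ℤ/N` (`(ℚ/ℤ)[N] ≅ ℤ/N`), and averaged over the orbit into a `g`-equivariant retraction.

## What is proved (`M` a `ℤ/N`-module, `g : M →ₗ M` with `g^m = 1`, `m ≥ 1`)

* `exists_extension_of_linearMap_zmod` — **`ℤ/N` is self-injective**: every `ℤ/N`-linear functional on a submodule
  `F ≤ M` extends to `M`.
* `exists_equivariant_retraction_of_linearIndependent_orbit` — if the orbit `v, g v, …, g^(m-1) v` is `ℤ/N`-linearly
  independent, there is a `g`-EQUIVARIANT `ℤ/N`-linear `π : M → M` with `π (gⁱ v) = gⁱ v` and `π(M) ≤ F := span{gⁱ v}`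
  (`π x = ∑_{t<m} Λ(gᵗ x) · g^(m-t) v` for an extension `Λ` of the `0`-th orbit coordinate).
* `exists_isCompl_stable_of_linearIndependent_orbit` — hence **`M = F ⊕ C` with `C = ker π` a `g`-stable submodule**:
  the free orbit (a copy of `(ℤ/N)[C_m]`) is a `g`-stable direct summand.  With calibration I–III
  (`…FreeMultCalibration`, `…FreeMultHomogeneous`, `…FreeMultSmallRank`) the free multiplicity of `M` is that of
  `(ℤ/N)[C_m]` plus that of `C`. [folklore]
-/

noncomputable section

set_option autoImplicit false
set_option linter.dupNamespace false

open Finset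
open Literature.GroupTheory.FiniteAbelian

namespace Summit.BirchSwinnertonDyer.BirchSwinnertonDyer.Theorems.SignedMuAtTwo.EvenSymplecticFreeParity

/-! ### §1 `(ℚ/ℤ)[N] ≅ ℤ/N` and the self-injectivity of `ℤ/N` -/

/-- **`ℤ/N ↪ ℚ/ℤ` onto the `N`-torsion**: an injective additive `ι : ZMod N → ℚ/ℤ` (`k ↦ k/N`) whose range contains every
`u` with `N • u = 0`. [folklore] -/
theorem exists_zmod_addMonoidHom_addCircle (N : ℕ) [NeZero N] :
    ∃ ι : ZMod N →+ AddCircle (1 : ℚ), Function.Injective ι ∧ ∀ u : AddCircle (1 : ℚ), N • u = 0 → ∃ t, ι t = u := by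
  haveI : Fact ((0 : ℚ) < 1) := ⟨one_pos⟩
  have hN : 0 < N := Nat.pos_of_ne_zero (NeZero.ne N)
  set c : AddCircle (1 : ℚ) := (((1 : ℚ) / N : ℚ) : AddCircle (1 : ℚ)) with hc
  have hcord : addOrderOf c = N := AddCircle.addOrderOf_period_div hN
  let ι : ZMod N →+ AddCircle (1 : ℚ) := ZMod.lift N ⟨zmultiplesHom (AddCircle (1 : ℚ)) c, by
    change (N : ℤ) • c = 0
    rw [natCast_zsmul, ← hcord, addOrderOf_nsmul_eq_zero]⟩
  have hι : ∀ k : ℤ, ι (k : ZMod N) = k • c := fun k ↦ by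
    change ZMod.lift N _ (k : ZMod N) = _
    rw [ZMod.lift_coe]; rfl
  refine ⟨ι, ?_, ?_⟩
  · rw [injective_iff_map_eq_zero]
    intro t ht
    obtain ⟨k, rfl⟩ := ZMod.intCast_surjective t
    rw [hι, ← addOrderOf_dvd_iff_zsmul_eq_zero, hcord] at ht
    exact (ZMod.intCast_zmod_eq_zero_iff_dvd k N).mpr ht
  · intro u hu
    rw [AddCircle.nsmul_eq_zero_iff hN] at hu
    obtain ⟨k, -, rfl⟩ := hu
    refine ⟨((k : ℤ) : ZMod N), ?_⟩
    rw [hι, hc, ← AddCircle.coe_zsmul, zsmul_eq_mul, Int.cast_natCast, mul_one, mul_one_div]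

/-- **Self-injectivity of `ℤ/N` (extension of functionals).** For a `ℤ/N`-module `M`, a submodule `F` and a
`ℤ/N`-linear functional `lam : F → ℤ/N`, there is a `ℤ/N`-linear `Λ : M → ℤ/N` extending `lam`: compose with
`ι : ℤ/N ↪ ℚ/ℤ`, extend over `ℤ` by divisibility of `ℚ/ℤ` (`CharacterModule.dual_surjective_of_injective`), and pull back
through `ι` (all values are `N`-torsion). [folklore] -/
theorem exists_extension_of_linearMap_zmod {N : ℕ} [NeZero N] {M : Type*} [AddCommGroup M] [Module (ZMod N) M]
    (F : Submodule (ZMod N) M) (lam : F →ₗ[ZMod N] ZMod N) :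
    ∃ Λ : M →ₗ[ZMod N] ZMod N, ∀ x : F, Λ (x : M) = lam x := by
  obtain ⟨ι, hιinj, hιsurj⟩ := exists_zmod_addMonoidHom_addCircle N
  -- extend `ι ∘ lam` over `ℤ`
  obtain ⟨Λ', hΛ'⟩ := CharacterModule.dual_surjective_of_injective F.subtype.toAddMonoidHom.toIntLinearMap
    (fun x y h ↦ Subtype.ext h) ((ι.comp lam.toAddMonoidHom : F →+ AddCircle (1 : ℚ)))
  have hΛ'F : ∀ x : F, Λ' (x : M) = ι (lam x) := fun x ↦ by
    have h := DFunLike.congr_fun hΛ' x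
    rw [CharacterModule.dual_apply] at h
    exact h
  -- all values are `N`-torsion, hence in the range of `ι`
  have hval : ∀ y : M, ∃ t : ZMod N, ι t = Λ' y := fun y ↦ hιsurj _ (by
    rw [← map_nsmul, ← Nat.cast_smul_eq_nsmul (ZMod N) N y, ZMod.natCast_self, zero_smul, map_zero])
  choose θ hθ using hval
  have hθadd : ∀ y z, θ (y + z) = θ y + θ z := fun y z ↦ hιinj (by rw [map_add, hθ, hθ, hθ, map_add])
  let Θ : M →+ ZMod N := { toFun := θ, map_zero' := hιinj (by rw [hθ, map_zero, map_zero]), map_add' := hθadd }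
  refine ⟨Θ.toZModLinearMap N, fun x ↦ hιinj ?_⟩
  change ι (θ x) = _
  rw [hθ, hΛ'F]

/-! ### §2 The equivariant retraction onto a free orbit -/

section Orbit

variable {N : ℕ} [NeZero N] {M : Type*} [AddCommGroup M] [Module (ZMod N) M]
  (g : M →ₗ[ZMod N] M) {m : ℕ} (hm : 0 < m) (hg : g ^ m = 1) (v : M)
  (hli : LinearIndependent (ZMod N) (fun i : Fin m ↦ (g ^ (i : ℕ)) v))

include hg in
omit [NeZero N] in
/-- `g^s v` depends on `s mod m` only. [folklore] -/
theorem pow_apply_eq_pow_mod_apply (s : ℕ) (x : M) : (g ^ s) x = (g ^ (s % m)) x := by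
  conv_lhs => rw [← Nat.mod_add_div s m, pow_add, pow_mul, hg, one_pow, mul_one]

include hm hg hli in
/-- **The `g`-equivariant retraction onto the free orbit.** With `F = span{v, g v, …, g^(m-1) v}` (a free orbit):
there is a `ℤ/N`-linear `π : M → M`, commuting with `g`, fixing every `gⁱ v`, with values in `F`. [folklore] -/
theorem exists_equivariant_retraction_of_linearIndependent_orbit :
    ∃ π : M →ₗ[ZMod N] M, (∀ x, π (g x) = g (π x)) ∧ (∀ i : Fin m, π ((g ^ (i : ℕ)) v) = (g ^ (i : ℕ)) v) ∧
      ∀ x, π x ∈ Submodule.span (ZMod N) (Set.range fun i : Fin m ↦ (g ^ (i : ℕ)) v) := by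
  set F := Submodule.span (ZMod N) (Set.range fun i : Fin m ↦ (g ^ (i : ℕ)) v) with hF
  haveI : NeZero m := ⟨hm.ne'⟩
  -- the `0`-th coordinate of the orbit basis, extended to `M`
  let b := Module.Basis.span hli
  obtain ⟨Λ, hΛ⟩ := exists_extension_of_linearMap_zmod F (b.coord (0 : Fin m))
  have hmemF : ∀ s : ℕ, (g ^ s) v ∈ F := fun s ↦ by
    rw [pow_apply_eq_pow_mod_apply g hg]
    exact Submodule.subset_span ⟨⟨s % m, Nat.mod_lt s hm⟩, rfl⟩
  have hΛv : ∀ s : ℕ, Λ ((g ^ s) v) = if m ∣ s then 1 else 0 := by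
    intro s
    rw [pow_apply_eq_pow_mod_apply g hg s]
    have hs : s % m < m := Nat.mod_lt s hm
    have h := hΛ ⟨(g ^ (s % m)) v, hmemF (s % m)⟩
    rw [h, Module.Basis.coord_apply,
      show (⟨(g ^ (s % m)) v, hmemF (s % m)⟩ : F) = ⟨(fun i : Fin m ↦ (g ^ (i : ℕ)) v) ⟨s % m, hs⟩,
        Submodule.subset_span (Set.mem_range_self _)⟩ from rfl,
      Module.Basis.span_repr_eq_single hli ⟨s % m, hs⟩, Finsupp.single_apply]
    by_cases hd : m ∣ s
    · rw [if_pos hd, if_pos (Fin.ext (by simpa using (Nat.dvd_iff_mod_eq_zero).mp hd))]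
    · rw [if_neg hd, if_neg (fun h ↦ hd ((Nat.dvd_iff_mod_eq_zero).mpr (by simpa using congrArg Fin.val h)))]
  -- the averaged retraction `π x = ∑_{t<m} Λ(gᵗ x) • g^(m-t) v`
  let π : M →ₗ[ZMod N] M :=
    ∑ t ∈ range m, (LinearMap.toSpanSingleton (ZMod N) M ((g ^ (m - t)) v)).comp (Λ.comp (g ^ t))
  have hπ : ∀ x, π x = ∑ t ∈ range m, Λ ((g ^ t) x) • (g ^ (m - t)) v := fun x ↦ by
    simp only [π, LinearMap.coe_sum, Finset.sum_apply, LinearMap.comp_apply,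
      LinearMap.toSpanSingleton_apply]
  have hgpow : ∀ (a b : ℕ) (y : M), (g ^ a) ((g ^ b) y) = (g ^ (a + b)) y := fun a b y ↦ by
    rw [← Module.End.mul_apply, ← pow_add]
  refine ⟨π, fun x ↦ ?_, fun i ↦ ?_, fun x ↦ ?_⟩
  · -- equivariance: telescoping `∑_{t<m} f(t+1) = ∑_{t<m} f(t)` since `f(m) = f(0)`
    rw [hπ, hπ, map_sum]
    set f : ℕ → M := fun s ↦ Λ ((g ^ s) x) • (g ^ (m + 1 - s)) v with hf
    have h1 : ∀ t ∈ range m, Λ ((g ^ t) (g x)) • (g ^ (m - t)) v = f (t + 1) := by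
      intro t ht
      rw [mem_range] at ht
      rw [hf]
      dsimp only
      rw [show (g ^ t) (g x) = (g ^ t) ((g ^ 1) x) by rw [pow_one], hgpow,
        show m + 1 - (t + 1) = m - t by omega]
    have h2 : ∀ t ∈ range m, g (Λ ((g ^ t) x) • (g ^ (m - t)) v) = f t := by
      intro t ht
      rw [mem_range] at ht
      rw [hf]
      dsimp only
      rw [map_smul, show g ((g ^ (m - t)) v) = (g ^ 1) ((g ^ (m - t)) v) by rw [pow_one], hgpow,
        show 1 + (m - t) = m + 1 - t by omega]
    rw [sum_congr rfl h1, sum_congr rfl h2]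
    have e1 : ∑ t ∈ range m, f (t + 1) + f 0 = ∑ t ∈ range (m + 1), f t := (sum_range_succ' f m).symm
    have e2 : ∑ t ∈ range m, f t + f m = ∑ t ∈ range (m + 1), f t := (sum_range_succ f m).symm
    have key : f 0 = f m := by
      rw [hf]
      dsimp only
      rw [pow_zero, Module.End.one_apply, hg, Module.End.one_apply, Nat.sub_zero, Nat.add_sub_cancel_left,
        pow_succ, hg, one_mul, pow_one]
    rw [key] at e1
    exact add_right_cancel (e1.trans e2.symm)
  · -- `π` fixes the orbit: only the term `t = (m - i) % m` survives
    rw [hπ]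
    have hterm : ∀ t : ℕ, Λ ((g ^ t) ((g ^ (i : ℕ)) v)) = if m ∣ t + (i : ℕ) then 1 else 0 := fun t ↦ by
      rw [hgpow, hΛv]
    simp_rw [hterm]
    have hi := i.2
    by_cases hi0 : (i : ℕ) = 0
    · rw [Finset.sum_eq_single_of_mem 0 (mem_range.mpr hm)]
      · rw [hi0, add_zero, if_pos (dvd_zero m), one_smul, Nat.sub_zero, hg, pow_zero]
      · intro t ht hne
        rw [mem_range] at ht
        rw [hi0, add_zero, if_neg (fun h ↦ hne (Nat.eq_zero_of_dvd_of_lt h ht)), zero_smul]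
    · rw [Finset.sum_eq_single_of_mem (m - (i : ℕ)) (mem_range.mpr (by omega))]
      · rw [Nat.sub_add_cancel hi.le, if_pos (dvd_refl m), one_smul,
          show m - (m - (i : ℕ)) = (i : ℕ) by omega]
      · intro t ht hne
        rw [mem_range] at ht
        rw [if_neg, zero_smul]
        rintro ⟨c, hc⟩
        have hc2 : c < 2 := by
          by_contra hle
          have : m * 2 ≤ m * c := Nat.mul_le_mul_left m (by omega)
          omega
        interval_cases c <;> omega
  · rw [hπ]
    exact Submodule.sum_mem _ fun t _ ↦ Submodule.smul_mem _ _ (hmemF _)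

include hm hg hli in
/-- **The free orbit is a `g`-stable direct summand.** With `F = span{v, g v, …, g^(m-1) v}` linearly independent over
`ℤ/N` and `g^m = 1`: there is a `g`-STABLE submodule `C` with `M = F ⊕ C` (`IsCompl F C`); `F` itself is `g`-stable.
This is the «projective–injective over the Frobenius ring `(ℤ/N)[C_m]`, hence splits off» step of stub S3. [folklore] -/
theorem exists_isCompl_stable_of_linearIndependent_orbit :
    ∃ C : Submodule (ZMod N) M, (∀ x ∈ C, g x ∈ C) ∧
      (∀ x ∈ Submodule.span (ZMod N) (Set.range fun i : Fin m ↦ (g ^ (i : ℕ)) v),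
        g x ∈ Submodule.span (ZMod N) (Set.range fun i : Fin m ↦ (g ^ (i : ℕ)) v)) ∧
      IsCompl (Submodule.span (ZMod N) (Set.range fun i : Fin m ↦ (g ^ (i : ℕ)) v)) C := by
  set F := Submodule.span (ZMod N) (Set.range fun i : Fin m ↦ (g ^ (i : ℕ)) v) with hF
  obtain ⟨π, hπg, hπv, hπF⟩ := exists_equivariant_retraction_of_linearIndependent_orbit g hm hg v hli
  -- `π` restricted to `F` is the identity
  have hπid : ∀ x ∈ F, π x = x := by
    intro x hx
    refine Submodule.span_induction (fun y hy ↦ ?_) (map_zero π) (fun y z _ _ hy hz ↦ by rw [map_add, hy, hz])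
      (fun a y _ hy ↦ by rw [map_smul, hy]) hx
    obtain ⟨i, rfl⟩ := hy
    exact hπv i
  let p : M →ₗ[ZMod N] F := LinearMap.codRestrict F π hπF
  have hp : ∀ x : F, p x = x := fun x ↦ Subtype.ext (hπid x x.2)
  refine ⟨LinearMap.ker p, fun x hx ↦ ?_, fun x hx ↦ ?_, LinearMap.isCompl_of_proj hp⟩
  · rw [LinearMap.mem_ker] at hx ⊢
    apply Subtype.ext
    have hx' : π x = 0 := congrArg Subtype.val hx
    change π (g x) = 0
    rw [hπg, hx', map_zero]
  · -- `g F ≤ F`: `g (gⁱ v) = g^(i+1) v ∈ F`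
    refine Submodule.span_induction (fun y hy ↦ ?_) (by rw [map_zero]; exact F.zero_mem)
      (fun y z _ _ hy hz ↦ by rw [map_add]; exact F.add_mem hy hz)
      (fun a y _ hy ↦ by rw [map_smul]; exact F.smul_mem a hy) hx
    obtain ⟨i, rfl⟩ := hy
    rw [show g ((g ^ (i : ℕ)) v) = (g ^ 1) ((g ^ (i : ℕ)) v) by rw [pow_one], ← Module.End.mul_apply, ← pow_add,
      pow_apply_eq_pow_mod_apply g hg]
    exact Submodule.subset_span ⟨⟨(1 + (i : ℕ)) % m, Nat.mod_lt _ hm⟩, rfl⟩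

end Orbit

end Summit.BirchSwinnertonDyer.BirchSwinnertonDyer.Theorems.SignedMuAtTwo.EvenSymplecticFreeParity

end
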